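import Summits.HubbardSuperconductivity.HubbardSuperconductivity.Theorems.AnisotropyChordTransferFibre3TwoHoleBSNearOrbit

/-!
# Route `AnisotropyChord` / H0 rotor rung: HOLE₂(.75) for `L ≥ 8192` REDUCED TO THE REMAINING OFFSET CLASSES (overlapping crosses and far pairs)

Twenty-second file of the `TwoHoleBS` (PROP BS) chain: bookkeeping of what the near-pair theorems leave.  With
`…TwoHoleBSNearOrbit.hole2_near_disjoint_allL` (all 36 offsets `|d|∞ ≤ 3`, `|d|₁ ≥ 3`, every `L ≥ 8192`) and
`…TwoHoleBSCovariance.twoHoleGap_of_dualCert_origin` (translations):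
* ★ `twoHoleGap_allL_of_rest`: for `L ≥ 8192`, **`TwoHoleGap L (¾ε₁)` (HOLE₂(.75), the one-body hypothesis of `gm3_of_hole2`) follows from
  dual certificates for the pairs `(0, d)` whose offset `d ≠ 0` is NOT the cast of a near disjoint-cross offset** — i.e. the
  overlapping-cross classes `d ∈ D₄·{(1,0),(1,1),(2,0)}` and the far offsets (no representative with `|d|∞ ≤ 3`).
Prover seat `hubbard-h0-rotor-p2` g3; helper for stmt-HubbardSuperconductivity-19089 (`--supports`, helper class).
WHAT THIS IS NOT: nothing here proves superconductivity in the Hubbard model; the rotor TARGET as originally worded stays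
FALSE (g15 verdict).  A reduction statement: the remaining classes (overlapping crosses: a reduced-slot skeleton formalism; far
pairs: `d`-uniform torus difference bounds) are open in the tree, as is `37 ≤ L < 8192`.  Mathlib + tree imports only; no sorry, no axioms.
-/

set_option linter.dupNamespace false
set_option autoImplicit false

namespace Summit.HubbardSuperconductivity.HubbardSuperconductivity.Theorems.AnisotropyChord.Transfer.Fibre3

namespace TwoHoleBS

variable (L : ℕ) [NeZero L]

/-- the near disjoint-cross offsets: `|a|, |b| ≤ 3`, `|a| + |b| ≥ 3`. [folklore] -/
def NearDisjointOffset (a b : ℤ) : Prop := |a| ≤ 3 ∧ |b| ≤ 3 ∧ 3 ≤ |a| + |b|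

/-- ★ **HOLE₂(.75) at `L ≥ 8192` from the remaining classes:** if every pair `(0, d)` with `d ≠ 0` NOT of the form
`castPt L (a, b)` with `NearDisjointOffset a b` admits a dual certificate at `g = ¾ε₁`, then `TwoHoleGap L (¾ε₁)`. [folklore] -/
theorem twoHoleGap_allL_of_rest (hL : 8192 ≤ L)
    (hrest : ∀ d : Tor L, d ≠ 0 →
      (∀ a b : ℤ, NearDisjointOffset a b → d ≠ castPt L (a, b)) → DualCert L (3 / 4 * eps1 L) 0 d) :
    TwoHoleGap L (3 / 4 * eps1 L) := by
  have he := RateLemma.eps1_pos_of_two_le L (by omega)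
  refine twoHoleGap_of_dualCert_origin L (by omega) (by linarith) fun d hd => ?_
  by_cases h : ∃ a b : ℤ, NearDisjointOffset a b ∧ d = castPt L (a, b)
  · obtain ⟨a, b, ⟨ha, hb, hab⟩, rfl⟩ := h
    have := hole2_near_disjoint_allL L hL a b ha hb hab 0
    rwa [zero_add] at this
  · exact hrest d hd fun a b hnd heq => h ⟨a, b, hnd, heq⟩

end TwoHoleBS

end Summit.HubbardSuperconductivity.HubbardSuperconductivity.Theorems.AnisotropyChord.Transfer.Fibre3
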